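/-
Copyright (c) 2026 the pub-hodgecm-mathlib formalisation cell (harness21).  Prover seat hodgecm-mathlib-F0P2-p06 (g10): road «S3-tree» (LEAD F0P3a-plan (g11), architect
A-p16 (g29) rulings A-66 «SPAN-0» ∕ A-67 (1)(t2) ∕ A-71 (β′) ∕ A-73 (1): the CM dress of S-a3 and the head `span_isSelfDual`), 2026-09-01.
-/
import Literature.NumberTheory.Rogawski1990.UnitaryVertexStabilizerSpanCM                 -- ★ A-p16 (g29) S-c FILE B: `span_of_cover`, `span_isVertex`, `v_charpoly_coeff_le_one_of_residuallyUnipotent`; S-c FILE A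
import Literature.NumberTheory.Automorphic.UnitaryLatticeTreeFrameChange                  -- ★∕filed F0P2-p06 (g10) S-a3 §3 (i): frame change, S-a3 at congruent frames, uniformiser ∕ charpoly tokens
import Literature.NumberTheory.Automorphic.UnitaryLatticeTreeTypeTwoUnipotentFixedNeighbour  -- ★ p845896 F0P3a-p07 (g11) S-a3: `exists_isSelfDualLattice_gt_mapGL_eq_of_charpoly`
import Literature.NumberTheory.Automorphic.UnitaryLatticeTreeTypeTwoTransitive             -- ★ B-p14 (g35) T1d′: `forall_isVertexLattice_two_exists_mapGL_N₁_eq` (discharges `htr₂`)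
import Literature.NumberTheory.Automorphic.HyperspecialUnitaryCartanAdicCompletion         -- ★ `unramifiedLocalConjDatum_adicCompletion` (the unramified datum at `w`)
import HarnessLib

/-!
# «SPAN-0»: at a non-split unramified place of good reduction the pieces are supported in stabilisers of SELF-DUAL vertices — the head `span_isSelfDual`
# (Bruhat–Tits 1972 §10; Rogawski 1990 §4.9 Lemma 4.9.3; the CM dress of S-a3)

Topic `NumberTheory/Rogawski1990`; namespace `Literature.NumberTheory.Rogawski1990`.  THEOREMS ONLY (no definition, no instance, no notation, no named fact, no `sorry`); kernel
lane.  Cell `pub/hodgecm-mathlib` (D-0151), crux H413 = `stmt-HodgeConjecture-24833`; road «S3-tree», architect A-p16 (g29): A-66 re-cut «SPAN» as «SPAN-0» («pieces supported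
in stabilisers of SELF-DUAL (type-0) vertex lattices only»), A-67 (1)(t2) ∕ A-71 (β′) dealt its one missing input — the CM dress of S-a3 — to F0P2-p06 (g10), A-73 (1) fixed the
head: `span_isSelfDual` = ★ `span_of_cover` (S-c FILE B, A-p16 (g29)) at `P := fun g => IsSelfDualLattice σ_w ϖ (placeForm H′ w.1) (latt ↑g)`.
THE COVER (§1, `exists_isSelfDualLattice_mapGL_localNonsplitEquiv_eq_of_charpoly`): at a place `v` of `L⁺` non-split and UNRAMIFIED in the CM field `L` (`w ∣ v`, `c·w = w`),
for a `c`-hermitian `H′` with `det H′ ≠ 0` and GOOD REDUCTION at `w` (`H′_w ∈ GL₃(𝒪_w)`: the pair `hH′w`, `hH′i` of ★ `isLocalUnitTransfer_of_nonsplit_of_isUnit_two` ∕ T3′), every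
`δ ∈ U(H′)(L⁺_v)` with `|coeff_i charpoly(e δ) − coeff_i charpoly 1| < 1` (`i < 3`) fixes a SELF-DUAL vertex: `∃ g, IsSelfDualLattice σ_w ϖ H′_w (latt g) ∧ e(δ)·latt g = latt g`.
Proof: ★ S-c FILE A `exists_isVertex_mapGL_localNonsplitEquiv_eq_of_charpoly` gives SOME fixed vertex `latt g` of type `d`; the good-reduction frame ★
`exists_glInt_placeForm_eq_formCongr_antidiagonal_of_isUnramifiedIn` writes `H′_w = (σ_w T)ᵀ J₀ T`, so `T·latt g` is a `J₀`-vertex of type `d` (★ frame change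
`isVertexLattice_formCongr_iff`) and `d ∈ {0, 2}` (★ T1b `type_eq_zero_or_two_of_isVertexLattice_three`, `|det J₀| = 1`); `d = 0` is the claim; for `d = 2` the type-two
fixed-neighbour lemma S-a3 (★ `exists_isSelfDualLattice_gt_mapGL_eq_of_charpoly`, F0P3a-p07 (g11); `htr₂` discharged by ★ T1d′ `forall_isVertexLattice_two_exists_mapGL_N₁_eq`,
B-p14 (g35)), transported to the frame `(σ_w T)ᵀ J₀ T` by ★ `exists_isSelfDualLattice_gt_mapGL_eq_of_charpoly_formCongr`, yields a fixed self-dual neighbour.  The unramified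
datum `hd : UnramifiedLocalConjDatum σ_w ϖ` is ★ `unramifiedLocalConjDatum_adicCompletion` at SOME uniformiser `ϖ₀`; the vertex predicates see `ϖ` only through `|ϖ|`
(★ `isSelfDualLattice_congr_of_v_eq`), so the head holds for EVERY uniformiser `ϖ` (§2), exactly in ★ `span_isVertex`'s shape plus the two standing hypotheses «`v` unramified»,
«good reduction at `w`».  PARITY NOTE: without good reduction, at a `w` with `v_w(det H′)` odd there is NO self-dual lattice for `H′_w` (the hyperspecial vertices have type 3) —
the good-reduction pair is load-bearing for «SPAN-0».
HONEST LABEL: HC_CM is proved only modulo the 2 remaining named inputs (hLiu418 24832, h413 24833) until rung 0 closes; nothing printed is asserted here; S3 (`stub_N6nsS3id`)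
stays a print row until the road's END lands.

* §1 `v_det_antidiagonal_three_eq_one`, **`exists_isSelfDualLattice_mapGL_localNonsplitEquiv_eq_of_charpoly_of_datum`** (cover, datum `hd` given),
  **`exists_isSelfDualLattice_mapGL_localNonsplitEquiv_eq_of_charpoly`** (cover, any uniformiser; hypothesis-free up to unramified + good reduction).
* §2 **`span_isSelfDual`** («SPAN-0»: ★ `span_of_cover` at `P := IsSelfDualLattice`).

## References
* [BruhatTits1972] F. Bruhat, J. Tits, *Groupes réductifs sur un corps local I*, Publ. Math. IHÉS 41 (1972), §10.
* [Rogawski1990] J. D. Rogawski, *Automorphic Representations of Unitary Groups in Three Variables*, Ann. of Math. Stud. 123 (1990), §4.9 Lemma 4.9.3 p. 56, Prop. 4.9.1 (a) p. 55.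
* [LanglandsShelstad1990Descent] R. Langlands, D. Shelstad, *Descent for transfer factors*, The Grothendieck Festschrift II (1990), §2.1 (localisation of transfer near a semisimple element).
* [PlatonovRapinchuk1994] V. Platonov, A. Rapinchuk, *Algebraic Groups and Number Theory* (1994), §3.3, §5.1.
-/

set_option autoImplicit false

noncomputable section

open scoped Valued WithZero Matrix MatrixGroups
open Topology Set NumberField IsDedekindDomain Matrix

namespace Literature.NumberTheory.Rogawski1990

open Literature.NumberTheory.Automorphic Literature.NumberTheory.Automorphic.UnitaryGroup Literature.NumberTheory.GaloisRepresentations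
open Literature.NumberTheory.Automorphic.UnitaryLatticeTree Literature.NumberTheory.Automorphic.HermitianLattice

variable (L : Type) [Field L] [NumberField L] [IsCMField L] (H' : Matrix (Fin 3) (Fin 3) L) (v : HeightOneSpectrum (𝓞 ↥(maximalRealSubfield L)))
  (w : PlacesOver L v) (hw : IsCMField.complexConj L • w.1 = w.1)

/-! ## §1 The self-dual fixed vertex of a residually unipotent element (non-split, unramified, good reduction) -/

/-- `|det J₀| = 1` for `J₀ = antidiag(1,1,1)` (`det J₀ = −1`). [cite: BruhatTits1972, §10] -/
theorem v_det_antidiagonal_three_eq_one (K : Type*) [Field K] [Valued K ℤᵐ⁰] : Valued.v ((StdForm.antidiagonal 3).over K).det = 1 := by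
  have hJ : ∀ i j : Fin 3, (StdForm.antidiagonal 3).over K i j = if j = Fin.rev i then (1 : K) else 0 := by
    intro i j
    simp only [StdForm.over, Matrix.map_apply, StdForm.antidiagonal_J_apply]
    split_ifs <;> simp
  have hdet : ((StdForm.antidiagonal 3).over K).det = -1 := by
    rw [Matrix.det_fin_three]; simp [hJ, Fin.rev]
  rw [hdet, Valuation.map_neg, map_one]

/-- **EVERY RESIDUALLY UNIPOTENT `δ ∈ U(H′)(L⁺_v)` FIXES A SELF-DUAL VERTEX — datum form** (`v` non-split, unramified; `H′` `c`-hermitian, `det H′ ≠ 0`, GOOD REDUCTION at `w`;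
`hd : UnramifiedLocalConjDatum σ_w ϖ`): if `|coeff_i charpoly(e δ) − coeff_i charpoly 1| < 1` for `i < 3` then `∃ g, IsSelfDualLattice σ_w ϖ (placeForm H′ w.1) (latt g) ∧
e(δ)·latt g = latt g` (★ S-c FILE A «some vertex» + ★ frame + ★ T1b types `{0,2}` + ★ S-a3 transported + ★ T1d′). [cite: BruhatTits1972, §10] [cite: Rogawski1990, §4.9 Lemma 4.9.3 p. 56] -/
theorem exists_isSelfDualLattice_mapGL_localNonsplitEquiv_eq_of_charpoly_of_datum
    (hH' : (H'.map (cmConjRingHom L))ᵀ = H') (hdet' : H'.det ≠ 0) (hv : Algebra.IsUnramifiedIn (𝓞 L) v.asIdeal)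
    (hH'w : IsUnit (placeForm H' w.1)) (hH'i : hH'w.unit ∈ glInt 3 (w.1.adicCompletion L))
    {ϖ : w.1.adicCompletion L} (hd : UnramifiedLocalConjDatum (galAdicCompletionMap (L := L) (IsCMField.complexConj L) hw) ϖ)
    (δ : (cmDatum L 3 H').Local v)
    (hδ1 : ∀ i < 3, Valued.v ((((localNonsplitEquiv (IsCMField.complexConj L) H' (IsCMField.complexConj_ne_one L) w hw δ :
        ↥(unitaryGroupOfForm (galAdicCompletionMap (L := L) (IsCMField.complexConj L) hw) (placeForm H' w.1))) :
          GL (Fin 3) (w.1.adicCompletion L)) : Matrix (Fin 3) (Fin 3) (w.1.adicCompletion L)).charpoly.coeff i -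
        (1 : Matrix (Fin 3) (Fin 3) (w.1.adicCompletion L)).charpoly.coeff i) < 1) :
    ∃ g : GL (Fin 3) (w.1.adicCompletion L),
      IsSelfDualLattice (galAdicCompletionMap (L := L) (IsCMField.complexConj L) hw) ϖ (placeForm H' w.1)
        (latt (g : Matrix (Fin 3) (Fin 3) (w.1.adicCompletion L))) ∧
      mapGL ((localNonsplitEquiv (IsCMField.complexConj L) H' (IsCMField.complexConj_ne_one L) w hw δ :
          ↥(unitaryGroupOfForm (galAdicCompletionMap (L := L) (IsCMField.complexConj L) hw) (placeForm H' w.1))) :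
            GL (Fin 3) (w.1.adicCompletion L)) (latt (g : Matrix (Fin 3) (Fin 3) (w.1.adicCompletion L))) =
        latt (g : Matrix (Fin 3) (Fin 3) (w.1.adicCompletion L)) := by
  set u := (localNonsplitEquiv (IsCMField.complexConj L) H' (IsCMField.complexConj_ne_one L) w hw δ :
    ↥(unitaryGroupOfForm (galAdicCompletionMap (L := L) (IsCMField.complexConj L) hw) (placeForm H' w.1))) with hu
  -- (1) SOME fixed vertex, of type `d`
  obtain ⟨g, ⟨d, hdg⟩, hfix⟩ := exists_isVertex_mapGL_localNonsplitEquiv_eq_of_charpoly L v w hw H' hH' hdet' hd.vϖ δ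
    (v_charpoly_coeff_le_one_of_residuallyUnipotent _ hδ1)
  -- (2) the good-reduction frame `H′_w = (σ_w T)ᵀ J₀ T`, `T ∈ GL₃(𝒪_w)`
  obtain ⟨T, -, hT⟩ := exists_glInt_placeForm_eq_formCongr_antidiagonal_of_isUnramifiedIn (↥(maximalRealSubfield L)) L (IsCMField.complexConj L)
    (IsCMField.complexConj_ne_one L) 3 H' hH' v w hw hv hH'w hH'i
  have hdg' : IsVertexLattice (galAdicCompletionMap (L := L) (IsCMField.complexConj L) hw) ϖ
      (formCongr (galAdicCompletionMap (L := L) (IsCMField.complexConj L) hw) T ((StdForm.antidiagonal 3).over (w.1.adicCompletion L))) d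
      (latt (g : Matrix (Fin 3) (Fin 3) (w.1.adicCompletion L))) := by
    rw [← hT]; exact hdg
  -- (3) `d ∈ {0, 2}`, read at `J₀` through the frame change
  rcases type_eq_zero_or_two_of_isVertexLattice_three hd.vσ hd.vϖ (v_det_antidiagonal_three_eq_one (w.1.adicCompletion L))
      ((isVertexLattice_formCongr_iff T _ d _).1 hdg') with rfl | rfl
  · exact ⟨g, hdg, hfix⟩
  · -- (4) type two: S-a3 at `J₀` (★ p07, `htr₂` by ★ T1d′), transported to the frame of `H′_w`, gives a fixed self-dual neighbour
    have huU : (u : GL (Fin 3) (w.1.adicCompletion L)) ∈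
        unitaryGroupOfForm (galAdicCompletionMap (L := L) (IsCMField.complexConj L) hw)
          (formCongr (galAdicCompletionMap (L := L) (IsCMField.complexConj L) hw) T ((StdForm.antidiagonal 3).over (w.1.adicCompletion L))) := by
      rw [← hT]; exact u.2
    obtain ⟨M, hM, -, hMfix⟩ := exists_isSelfDualLattice_gt_mapGL_eq_of_charpoly_formCongr T
      (fun _ hδ' hδ1' _ hN hδN => exists_isSelfDualLattice_gt_mapGL_eq_of_charpoly hd (forall_isVertexLattice_two_exists_mapGL_N₁_eq hd) hδ' hδ1' hN hδN)
      huU (forall_v_charpoly_sub_lt_one_of_lt_three _ hδ1) hdg' hfix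
    obtain ⟨g', hMg', -⟩ := id hM
    refine ⟨g', ?_, ?_⟩
    · rw [hT, ← hMg']; exact hM
    · rw [← hMg']; exact hMfix

/-- **EVERY RESIDUALLY UNIPOTENT `δ ∈ U(H′)(L⁺_v)` FIXES A SELF-DUAL VERTEX — for every uniformiser `ϖ`** (the datum comes from ★ `unramifiedLocalConjDatum_adicCompletion`,
the uniformiser is exchanged by ★ `isSelfDualLattice_congr_of_v_eq`); this is the `hcov` of ★ `span_of_cover` at `P := IsSelfDualLattice`. [cite: BruhatTits1972, §10]
[cite: Rogawski1990, §4.9 Lemma 4.9.3 p. 56] -/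
theorem exists_isSelfDualLattice_mapGL_localNonsplitEquiv_eq_of_charpoly
    (hH' : (H'.map (cmConjRingHom L))ᵀ = H') (hdet' : H'.det ≠ 0) (hv : Algebra.IsUnramifiedIn (𝓞 L) v.asIdeal)
    (hH'w : IsUnit (placeForm H' w.1)) (hH'i : hH'w.unit ∈ glInt 3 (w.1.adicCompletion L))
    {ϖ : w.1.adicCompletion L} (hϖ : Valued.v ϖ = WithZero.exp (-1 : ℤ))
    (δ : (cmDatum L 3 H').Local v)
    (hδ1 : ∀ i < 3, Valued.v ((((localNonsplitEquiv (IsCMField.complexConj L) H' (IsCMField.complexConj_ne_one L) w hw δ :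
        ↥(unitaryGroupOfForm (galAdicCompletionMap (L := L) (IsCMField.complexConj L) hw) (placeForm H' w.1))) :
          GL (Fin 3) (w.1.adicCompletion L)) : Matrix (Fin 3) (Fin 3) (w.1.adicCompletion L)).charpoly.coeff i -
        (1 : Matrix (Fin 3) (Fin 3) (w.1.adicCompletion L)).charpoly.coeff i) < 1) :
    ∃ g : GL (Fin 3) (w.1.adicCompletion L),
      IsSelfDualLattice (galAdicCompletionMap (L := L) (IsCMField.complexConj L) hw) ϖ (placeForm H' w.1)
        (latt (g : Matrix (Fin 3) (Fin 3) (w.1.adicCompletion L))) ∧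
      mapGL ((localNonsplitEquiv (IsCMField.complexConj L) H' (IsCMField.complexConj_ne_one L) w hw δ :
          ↥(unitaryGroupOfForm (galAdicCompletionMap (L := L) (IsCMField.complexConj L) hw) (placeForm H' w.1))) :
            GL (Fin 3) (w.1.adicCompletion L)) (latt (g : Matrix (Fin 3) (Fin 3) (w.1.adicCompletion L))) =
        latt (g : Matrix (Fin 3) (Fin 3) (w.1.adicCompletion L)) := by
  obtain ⟨ϖ₀, hd⟩ := unramifiedLocalConjDatum_adicCompletion (IsCMField.complexConj L) (IsCMField.complexConj_ne_one L) v w hw hv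
  obtain ⟨g, hg, hfix⟩ := exists_isSelfDualLattice_mapGL_localNonsplitEquiv_eq_of_charpoly_of_datum L H' v w hw hH' hdet' hv hH'w hH'i hd δ hδ1
  exact ⟨g, (isSelfDualLattice_congr_of_v_eq (by rw [hϖ, hd.vϖ]) _ _).1 hg, hfix⟩

/-! ## §2 «SPAN-0» — the pieces on SELF-DUAL vertex stabilisers -/

section Span

variable [iM' : ∀ γ : (cmDatum L 3 H').Local v, MeasurableSpace ((cmDatum L 3 H').Local v ⧸ Subgroup.centralizer ({γ} : Set ((cmDatum L 3 H').Local v)))]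
  [iB' : ∀ γ : (cmDatum L 3 H').Local v, BorelSpace ((cmDatum L 3 H').Local v ⧸ Subgroup.centralizer ({γ} : Set ((cmDatum L 3 H').Local v)))]

/-- **«SPAN-0» (A-66 ∕ A-73 (1)): at a non-split place `v` UNRAMIFIED in `L` where `H′` has GOOD REDUCTION, every `φ ∈ C_c^∞(U(H′)(L⁺_v))` has finitely many pieces `g k`,
each smooth, supported in a COMPACT OPEN stabiliser `K k` of a SELF-DUAL vertex lattice `latt g_k` and `Ad(K k)`-invariant, with `Σᶠ_c Δ(γH, out c)·Φ(c, φ) = Σ_k Σᶠ_c Δ·Φ(c, g k)`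
for all `G`-regular `γH` near `1`** — ★ `span_of_cover` at `P := IsSelfDualLattice σ_w ϖ H′_w (latt ·)` over the §1 cover.  This is the END-contract stub «SPAN» with the
self-dual `IsVertexStab` text of A-66 (1). [cite: Rogawski1990, §4.9 Lemma 4.9.3 p. 56] [cite: LanglandsShelstad1990Descent, §2.1] [cite: BruhatTits1972, §10] -/
theorem span_isSelfDual (hH' : (H'.map (cmConjRingHom L))ᵀ = H') (hdet' : H'.det ≠ 0) (hv : Algebra.IsUnramifiedIn (𝓞 L) v.asIdeal)
    (hH'w : IsUnit (placeForm H' w.1)) (hH'i : hH'w.unit ∈ glInt 3 (w.1.adicCompletion L))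
    {ϖ : w.1.adicCompletion L} (hϖ : Valued.v ϖ = WithZero.exp (-1 : ℤ))
    (T : LocalTransferFactor L H' v) {mG : OrbitalMeasureFamily ((cmDatum L 3 H').Local v)}
    (hmG : mG.IsAdmissibleOn fun γ' => IsRegularElt (γ'.val : GL (Fin 3) (LocalRing L v)))
    (φ : (cmDatum L 3 H').Local v → ℂ) (hφ : IsLocSmooth φ) :
    ∃ (n : ℕ) (K : Fin n → Subgroup ((cmDatum L 3 H').Local v)) (g : Fin n → (cmDatum L 3 H').Local v → ℂ),
      (∀ k, ∃ gk : GL (Fin 3) (w.1.adicCompletion L),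
        IsSelfDualLattice (galAdicCompletionMap (L := L) (IsCMField.complexConj L) hw) ϖ (placeForm H' w.1) (latt (gk : Matrix (Fin 3) (Fin 3) (w.1.adicCompletion L))) ∧
        IsCompact (K k : Set ((cmDatum L 3 H').Local v)) ∧ IsOpen (K k : Set ((cmDatum L 3 H').Local v)) ∧
        ∀ u : (cmDatum L 3 H').Local v, u ∈ K k ↔
          mapGL ((localNonsplitEquiv (IsCMField.complexConj L) H' (IsCMField.complexConj_ne_one L) w hw u :
              ↥(unitaryGroupOfForm (galAdicCompletionMap (L := L) (IsCMField.complexConj L) hw) (placeForm H' w.1))) :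
            GL (Fin 3) (w.1.adicCompletion L)) (latt (gk : Matrix (Fin 3) (Fin 3) (w.1.adicCompletion L))) = latt (gk : Matrix (Fin 3) (Fin 3) (w.1.adicCompletion L))) ∧
      (∀ k, IsLocSmooth (g k)) ∧ (∀ k, tsupport (g k) ⊆ (K k : Set ((cmDatum L 3 H').Local v))) ∧
      (∀ k, ∀ u ∈ K k, ∀ x, g k (u * x * u⁻¹) = g k x) ∧
      ∃ V ∈ 𝓝 (1 : (cmDatum L 2 (Matrix.of fun i j : Fin 2 => if i.val + j.val + 1 = 2 then (1 : L) else 0)).Local v ×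
          (cmDatum L 1 (Matrix.of fun i j : Fin 1 => if i.val + j.val + 1 = 1 then (1 : L) else 0)).Local v),
        ∀ γH ∈ V, IsLocalGRegular L v γH →
          (∑ᶠ c : ConjClasses ((cmDatum L 3 H').Local v), T.Δ γH (Quotient.out c) * classOrbitalIntegral mG φ c) =
            ∑ k, ∑ᶠ c : ConjClasses ((cmDatum L 3 H').Local v), T.Δ γH (Quotient.out c) * classOrbitalIntegral mG (g k) c :=
  span_of_cover L H' v w hw hH' hdet'
    (P := fun g => IsSelfDualLattice (galAdicCompletionMap (L := L) (IsCMField.complexConj L) hw) ϖ (placeForm H' w.1) (latt (g : Matrix (Fin 3) (Fin 3) (w.1.adicCompletion L))))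
    (fun δ hδ => exists_isSelfDualLattice_mapGL_localNonsplitEquiv_eq_of_charpoly L H' v w hw hH' hdet' hv hH'w hH'i hϖ δ hδ)
    T hmG φ hφ

end Span

end Literature.NumberTheory.Rogawski1990

end
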